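import Summits.QuantumFields.BalabanUV.Beta.D1BFx.RestKernelAbsMoment

/-!
# `BalabanUV.Beta.D1BFx.RestKernelWords` — road «BF-x» for binder row D1, slot (K): **THE N-SIDE REST KERNELS WORD BY WORD** («RK-WORDS», the
# per-word complement of the OWNER d1-p2-g14's aggregate «RK-ABS» `RestKernelAbsMoment`; DICT-CHAIN-SPEC v1.0.1 §1 (S-M2) «S-sized per word class»,
# §2 «rows … word by word»): the 3 + 15 BLOCK WORDS of `PackedKernelSplit.blockTerms` and the 1 + 3 SANDWICH CROSS WORDS of `PackedKernelSplit.legCross`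
# as NAMED word-indexed kernels `blockWord K V W u` ∕ `crossWord A B V W u`, each a well-typed (1.22)-kernel (`AbsMoment₂`, per word), with the class channel
# EQUAL to the word sum POINTWISE and IN (1.22)-MOMENT

HONEST DEPENDENCY (cell records, verbatim): «continuum YM on T⁴ ⇐ BetaPertH ∧ nine spine estimates (0/9 proved); BetaPertH ⇐ (D1) ∧ (D4) ∧
CAP+tail; G-an2-4 gates asym, D1 and NE2/3/4.»  HONEST FRAMING (cell contract, verbatim): «discharging `BetaPertH` makes Bałaban's UV stability
UNCONDITIONAL — a real constructive-QFT result; it is NOT the continuum limit and NOT the Clay problem.»  THIS MODULE DISCHARGES NOTHING of the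
wall: [folklore] kernel bookkeeping over leaf-03's `PackedKernelSplitBounds` (the per-word (5.10)-shape decay `decay510_tadpoleWord` ∕ `decay510_biBubbleWord`,
`vertexFamily_blk` ∕ `vertexFamily₂_blk`), `DecimatedMomentSummable.absMoment₂_of_decay510`, `tsum` linearity under `AbsMoment₂`, and `PackedKernelSplit`'s
definitions, plus two small [our object] DATA definitions (`blockWord`, `crossWord` — the words, sign and guard folded in; asserting nothing).  No `def … : Prop`, nothing cited, 0 sorry.  NO
n-uniform bound, NO leg envelope, NO table dictionary: the constants are per `n`; the unit-class rows RK-SAND ∕ RK-BLK of the SPEC remain OPEN.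
0 root-level binders of row D1 discharged; (K) NOT closed; NOT D1, NOT `BetaPertH`, NOT continuum, NOT Clay.

ABSOLUTE RULE (cell charter, verbatim): «No internally-minted statement may enter as a cited fact. Every hypothesis is either kernel-proved in
this package or a verbatim quotation of a PUBLISHED theorem with page reference. The manuscript(s) under audit are NOT citable for their own
disputed steps — they are the thing under adjudication; programme-internal (2001/route/tribunal) claims are never citable.»

WHY.  After «DICT-PTW» (p306436) the (K) row of road BF-x is ONE pointwise identity `hptw : TshotOf … μ ν z = ω_gl·gluon + ω_gh·ghost + Σ_u Rk u n μ ν z`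
plus `AbsMoment₂` rows `hMR` and read-out rows on the rest kernels `Rk u`; after «NLEG-HESS-SPLIT» (p306640) + «RK-ABS» the N-side rest kernels enter as
TWO CLASS CHANNELS (`legCross …`, `blockTerms …`) with `hMR` discharged per class.  The unit-class estimates (DICT-CHAIN-SPEC §2, rows RK-SAND ∕ RK-BLK) are
owed WORD BY WORD — 1 tadpole + 3 bi-bubbles with a sandwich leg `Ga𝒬ᵀCun′𝒬Ga`, 3 tadpoles + 15 bi-bubbles with an `ℋ_R` ∕ `ℋ♭_R` ∕ multiplier leg — each an
(IR) word estimated from its own legs.  This file is the frame those rows plug into: a caller may take `Rk u` WORD-indexed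
(`u ∈ (Bool × Bool) ⊕ (Bool × Bool × Bool × Bool)` for the block words, `u ∈ Unit ⊕ (Bool × Bool)` for the cross words), with `hMR` discharged per word here
and `Ru u` ∕ `CU u` supplied per word by the estimate rows; the class channel is the word sum on the nose (`blockTerms_eq_sum_blockWord`,
`legCross_eq_sum_crossWord`) and so is its (1.22) moment (`secondMoment_blockTerms`, `secondMoment_legCross`).

CONTENT.
* §1 [folklore, any `D`] `summable_moment_term`, **`secondMoment_eq_sum_of_pointwise`** (a pointwise finite word sum is read by (1.22) word by word — the
  `Σ`-only form of `RoadEndBFxDictPointwiseS.secondMoment_of_pointwise`, any dimension).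
* §2 [our object] `blockWord K V W u` (`u = inl (i,j)`: `½·𝟙[(i,j) ≠ (f,f)]·tadpole K_ij (W μ 0 ν z)_ji`; `u = inr (i,j,k,l)`: `−½·𝟙[not all f]·biBubble K_ij (V μ 0)_jk K_kl (V ν z)_li`);
  [folklore] **`blockTerms_eq_sum_blockWord`** (definitional re-indexing), **`absMoment₂_blockWord`** (decaying packed `K`, packed families at the coarse bonds ⇒
  every word, every channel), **`secondMoment_blockTerms`** (`M₂[blockTerms K V W]_{μν} = Σ_u M₂[blockWord K V W u]_{μν}`).
* §3 [our object] `crossWord A B V W u` (`inl ()`: `½·tadpole B (W μ 0 ν z)`; `inr (x,y)`: `−½·𝟙[x ∨ y]·biBubble L_x (V μ 0) L_y (V ν z)`, `L_true = B`, `L_false = A`);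
  [folklore] **`legCross_eq_sum_crossWord`**, **`absMoment₂_crossWord`**, **`secondMoment_legCross`**.
* §4 [folklore] ROAD INSTANCES mod `Spr (Ga (m+1) a)` ([B5] Prop. 1.2 ∧ (1.126)–(1.127) content BY NAME elsewhere): over `K := NlegRoad m a`
  (`RWeightedLegPack.spr_NlegRoad`) and over the split fine leg `A := ½•Ga (m+1) a`, `B := (−½)•(sandP …)_ff` of «NLEG-HESS-SPLIT» (`spr_smul'`, `spr_sandP`, `spr_blk`,
  `CoarseGramInverse.spr_multM`), for packed ∕ fine-fibre families at the coarse bonds of blocking `m + 1` — the hypotheses are LETTER FOR LETTER those of the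
  OWNER's class-level `RestKernelAbsMoment.absMoment₂_blockTerms_NlegRoad` ∕ `absMoment₂_legCross_NlegRoad`.
Unit `b2b-balaban-beta-d1-formalise-leaf-01` (gen 19), D1 formalisation swarm leaf prover 01, road «BF-x»; INTENT 2 «RK-WORDS» (journal l.36635).
-/

noncomputable section

open Finset
open scoped BigOperators
open Literature.MathematicalPhysics.QuantumFieldTheory.Balaban1983to89
open Literature.MathematicalPhysics.QuantumFieldTheory.Balaban1983to89.Beta
open B12Sec2to5 (l1 l1_nonneg Decay510)
open ExpKernelCalculus (Site MKer Decays BiLoc VertexFamily VertexFamily₂ comp tr tadpole bubble hessKer)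
open DecimatedMomentSummable (AbsMoment₂ IsMoment₂ summable_smul_of_absMoment₂ absMoment₂_of_decay510)
open StepDriftWitness (absMoment₂_zero_gen)
open HessianTelescopingKKT (absMoment₂_const_mul')
open OneStepResolventKernel (Fib)
open Summit.QuantumFields.BalabanUV.Beta.TameKernelCalculus (Spr Loc decays_of_le biLoc_of_le)
open Summit.QuantumFields.BalabanUV.Beta.D1BFx.PackedKernelSplit (blk biBubble legCross blockTerms decays_blk biLoc_blk spr_blk)
open Summit.QuantumFields.BalabanUV.Beta.D1BFx.PackedKernelSplitBounds (vertexFamily_blk vertexFamily₂_blk decay510_tadpoleWord decay510_biBubbleWord)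
open Summit.QuantumFields.BalabanUV.Beta.D1BFx.CoarseGramInverse (multM spr_multM)
open Summit.QuantumFields.BalabanUV.Beta.D1BFx.RWeightedLegPack (NlegRoad sandP spr_NlegRoad spr_sandP spr_smul')

namespace Summit.QuantumFields.BalabanUV.Beta.D1BFx.RestKernelWords

/-! ## §1 Generic: (1.22) reads a finite word sum word by word -/

section Generic

variable {D : ℕ}

/-- [folklore] Summability of the (1.22) summand of a channel with absolutely summable second moments (any dimension;
`DecimatedMomentSummable.summable_smul_of_absMoment₂` at the letter `y_μ y_ν`). -/
theorem summable_moment_term {f : Site D → ℝ} (hf : AbsMoment₂ f) (μ ν : Fin D) :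
    Summable fun x : Site D => f x * (x μ : ℝ) * (x ν : ℝ) := by
  refine (summable_smul_of_absMoment₂ hf (IsMoment₂.coord2 μ ν)).congr fun x => ?_
  rw [zsmul_eq_mul, Int.cast_mul]
  ring

/-- [folklore] **A POINTWISE FINITE WORD SUM IS READ BY THE (1.22) MOMENT WORD BY WORD** (any dimension): if the `(μ, ν)` channel of `T` is, entry by entry,
`Σ_u R u μ ν z` and every word channel has absolutely summable second moments, then `secondMoment T μ ν = Σ_u secondMoment (R u) μ ν`. -/
theorem secondMoment_eq_sum_of_pointwise {υ : Type*} [Fintype υ] {T : Fin D → Fin D → Site D → ℝ} {R : υ → Fin D → Fin D → Site D → ℝ}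
    {μ ν : Fin D} (hptw : ∀ z : Site D, T μ ν z = ∑ u, R u μ ν z) (hR : ∀ u, AbsMoment₂ (R u μ ν)) :
    B12Beta.secondMoment T μ ν = ∑ u, B12Beta.secondMoment (R u) μ ν := by
  classical
  have sR : ∀ u, Summable fun x : Site D => R u μ ν x * (x μ : ℝ) * (x ν : ℝ) := fun u => summable_moment_term (hR u) μ ν
  have e : ∀ x : Site D, T μ ν x * (x μ : ℝ) * (x ν : ℝ) = ∑ u, R u μ ν x * (x μ : ℝ) * (x ν : ℝ) := by
    intro x
    rw [hptw x, Finset.sum_mul, Finset.sum_mul]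
  unfold B12Beta.secondMoment
  rw [tsum_congr e, Summable.tsum_finsetSum (fun u _ => sR u)]

end Generic

/-! ## §2 The 3 + 15 block words -/

section Block

variable {D : ℕ} {F : Type*} [Fintype F]

/-- [our object] **THE BLOCK WORDS** of `PackedKernelSplit.blockTerms K V W`, sign and guard folded in: `inl (i, j)` ↦ the tadpole word
`½·tadpole K_ij (W μ 0 ν z)_ji` (zero at the all-field slot `(f, f) = (true, true)`), `inr (i, j, k, l)` ↦ the two-leg bubble word
`−½·biBubble K_ij (V μ 0)_jk K_kl (V ν z)_li` (zero at the all-field slot).  A DEFINITION; asserts nothing. -/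
def blockWord (K : MKer D (F ⊕ F)) (V : Fin D → Site D → MKer D (F ⊕ F)) (W : Fin D → Site D → Fin D → Site D → MKer D (F ⊕ F)) :
    (Bool × Bool) ⊕ (Bool × Bool × Bool × Bool) → Fin D → Fin D → Site D → ℝ
  | Sum.inl (i, j) => fun μ ν z => (1 / 2) * bif (i && j) then 0 else tadpole (blk K i j) (blk (W μ 0 ν z) j i)
  | Sum.inr (i, j, k, l) => fun μ ν z =>
      -(1 / 2) * bif (i && j && k && l) then 0 else biBubble (blk K i j) (blk (V μ 0) j k) (blk K k l) (blk (V ν z) l i)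

/-- [our object] **THE BLOCK CHANNEL IS THE WORD SUM, ENTRY BY ENTRY** (definitional re-indexing of `blockTerms`). -/
theorem blockTerms_eq_sum_blockWord (K : MKer D (F ⊕ F)) (V : Fin D → Site D → MKer D (F ⊕ F))
    (W : Fin D → Site D → Fin D → Site D → MKer D (F ⊕ F)) (μ ν : Fin D) (z : Site D) :
    blockTerms K V W μ ν z = ∑ u, blockWord K V W u μ ν z := by
  simp only [blockTerms, blockWord, Fintype.sum_sum_type, Fintype.sum_prod_type, Finset.mul_sum, neg_mul, Finset.sum_neg_distrib]
  ring

/-- [folklore] **EVERY BLOCK WORD IS A WELL-TYPED (1.22)-KERNEL**: for a decaying packed kernel `K` (rate `δK > 0`) and packed vertex∕table families `V`, `W` at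
the coarse bonds (rates `δv, δw > 0`, blocking `N ≥ 1`), every channel of every block word has absolutely summable second moments — the blocks inherit
`Decays`∕`BiLoc` (`decays_blk`, `vertexFamily_blk`, `vertexFamily₂_blk`), the rates are matched by monotonicity, then `PackedKernelSplitBounds.decay510_tadpoleWord` ∕
`decay510_biBubbleWord` and `absMoment₂_of_decay510`. -/
theorem absMoment₂_blockWord {K : MKer D (F ⊕ F)} {V : Fin D → Site D → MKer D (F ⊕ F)} {W : Fin D → Site D → Fin D → Site D → MKer D (F ⊕ F)}
    {C Cv Cw δK δv δw : ℝ} {N : ℕ} (hK : Decays K C δK) (hδK : 0 < δK) (hV : VertexFamily V N Cv δv) (hδv : 0 < δv)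
    (hW : VertexFamily₂ W N Cw δw) (hδw : 0 < δw) (hN : 1 ≤ N) (u : (Bool × Bool) ⊕ (Bool × Bool × Bool × Bool)) (μ ν : Fin D) :
    AbsMoment₂ (blockWord K V W u μ ν) := by
  set δ : ℝ := min δK (min δv δw) with hδdef
  have hδ : 0 < δ := lt_min hδK (lt_min hδv hδw)
  have hK' : Decays K (|C|) δ := decays_of_le hK (min_le_left _ _)
  have hV' : VertexFamily V N (|Cv|) δ := fun μ' y => biLoc_of_le (hV μ' y) ((min_le_right _ _).trans (min_le_left _ _))
  have hW' : VertexFamily₂ W N (|Cw|) δ := fun μ' y ν' y' => biLoc_of_le (hW μ' y ν' y') ((min_le_right _ _).trans (min_le_right _ _))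
  rcases u with ⟨i, j⟩ | ⟨i, j, k, l⟩
  · cases hb : (i && j)
    · have h := decay510_tadpoleWord (decays_blk hK' i j) (vertexFamily₂_blk hW' j i) hδ hN μ ν
      simp only [blockWord, hb, cond_false]
      exact absMoment₂_const_mul' (absMoment₂_of_decay510 (by linarith) h) _
    · simp only [blockWord, hb, cond_true, mul_zero]
      exact absMoment₂_zero_gen
  · cases hb : (i && j && k && l)
    · -- the word pairs the `(j,k)` block at the base bond with the `(l,i)` block at the running bond
      have h := decay510_biBubbleWord (decays_blk hK' i j) (decays_blk hK' k l) (vertexFamily_blk hV' j k) (vertexFamily_blk hV' l i) hδ hN μ ν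
      simp only [blockWord, hb, cond_false]
      exact absMoment₂_const_mul' (absMoment₂_of_decay510 (by linarith) h) _
    · simp only [blockWord, hb, cond_true, mul_zero]
      exact absMoment₂_zero_gen

/-- [folklore] **THE (1.22) MOMENT OF THE BLOCK CHANNEL IS THE SUM OF THE WORD MOMENTS**: under the hypotheses of `absMoment₂_blockWord`,
`secondMoment (blockTerms K V W) μ ν = Σ_u secondMoment (blockWord K V W u) μ ν` (3 + 15 genuine words; the two all-field slots read `0`). -/
theorem secondMoment_blockTerms {K : MKer D (F ⊕ F)} {V : Fin D → Site D → MKer D (F ⊕ F)} {W : Fin D → Site D → Fin D → Site D → MKer D (F ⊕ F)}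
    {C Cv Cw δK δv δw : ℝ} {N : ℕ} (hK : Decays K C δK) (hδK : 0 < δK) (hV : VertexFamily V N Cv δv) (hδv : 0 < δv)
    (hW : VertexFamily₂ W N Cw δw) (hδw : 0 < δw) (hN : 1 ≤ N) (μ ν : Fin D) :
    B12Beta.secondMoment (blockTerms K V W) μ ν = ∑ u, B12Beta.secondMoment (blockWord K V W u) μ ν :=
  secondMoment_eq_sum_of_pointwise (fun z => blockTerms_eq_sum_blockWord K V W μ ν z) fun u => absMoment₂_blockWord hK hδK hV hδv hW hδw hN u μ ν

end Block

/-! ## §3 The 1 + 3 sandwich cross words -/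

section Cross

variable {D : ℕ} {F : Type*} [Fintype F]

/-- [our object] **THE CROSS WORDS** of `PackedKernelSplit.legCross A B V W` (the leg split `A + B`), sign and guard folded in: `inl ()` ↦ `½·tadpole B (W μ 0 ν z)`;
`inr (x, y)` ↦ `−½·biBubble L_x (V μ 0) L_y (V ν z)` with `L_true = B`, `L_false = A`, zero at `(x, y) = (false, false)` (the pure-`A` bubble belongs to
`hessKer A V W`).  A DEFINITION; asserts nothing. -/
def crossWord (A B : MKer D F) (V : Fin D → Site D → MKer D F) (W : Fin D → Site D → Fin D → Site D → MKer D F) :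
    Unit ⊕ (Bool × Bool) → Fin D → Fin D → Site D → ℝ
  | Sum.inl _ => fun μ ν z => (1 / 2) * tadpole B (W μ 0 ν z)
  | Sum.inr (x, y) => fun μ ν z =>
      -(1 / 2) * bif (x || y) then biBubble (bif x then B else A) (V μ 0) (bif y then B else A) (V ν z) else 0

/-- [our object] **THE CROSS CHANNEL IS THE WORD SUM, ENTRY BY ENTRY** (definitional re-indexing of `legCross`). -/
theorem legCross_eq_sum_crossWord (A B : MKer D F) (V : Fin D → Site D → MKer D F) (W : Fin D → Site D → Fin D → Site D → MKer D F)
    (μ ν : Fin D) (z : Site D) :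
    legCross A B V W μ ν z = ∑ u, crossWord A B V W u μ ν z := by
  simp only [legCross, crossWord, Fintype.sum_sum_type, Fintype.sum_unique, Fintype.sum_prod_type, Fintype.sum_bool, Bool.or_true, Bool.or_false,
    cond_true, cond_false]
  ring

/-- [folklore] **EVERY CROSS WORD IS A WELL-TYPED (1.22)-KERNEL**: for legs `A`, `B` decaying at positive rates and vertex∕table families `V`, `W` at the coarse bonds
(positive rates, blocking `N ≥ 1`), every channel of every cross word has absolutely summable second moments. -/
theorem absMoment₂_crossWord {A B : MKer D F} {V : Fin D → Site D → MKer D F} {W : Fin D → Site D → Fin D → Site D → MKer D F}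
    {CA CB Cv Cw δA δB δv δw : ℝ} {N : ℕ} (hA : Decays A CA δA) (hδA : 0 < δA) (hB : Decays B CB δB) (hδB : 0 < δB)
    (hV : VertexFamily V N Cv δv) (hδv : 0 < δv) (hW : VertexFamily₂ W N Cw δw) (hδw : 0 < δw) (hN : 1 ≤ N) (u : Unit ⊕ (Bool × Bool))
    (μ ν : Fin D) : AbsMoment₂ (crossWord A B V W u μ ν) := by
  set δ : ℝ := min (min δA δB) (min δv δw) with hδdef
  have hδ : 0 < δ := lt_min (lt_min hδA hδB) (lt_min hδv hδw)
  have hA' : Decays A (|CA|) δ := decays_of_le hA ((min_le_left _ _).trans (min_le_left _ _))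
  have hB' : Decays B (|CB|) δ := decays_of_le hB ((min_le_left _ _).trans (min_le_right _ _))
  have hV' : VertexFamily V N (|Cv|) δ := fun μ' y => biLoc_of_le (hV μ' y) ((min_le_right _ _).trans (min_le_left _ _))
  have hW' : VertexFamily₂ W N (|Cw|) δ := fun μ' y ν' y' => biLoc_of_le (hW μ' y ν' y') ((min_le_right _ _).trans (min_le_right _ _))
  have hleg : ∀ b : Bool, ∃ Cl : ℝ, Decays (bif b then B else A) Cl δ := fun b => by
    cases b
    · exact ⟨_, hA'⟩
    · exact ⟨_, hB'⟩
  rcases u with _ | ⟨x, y⟩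
  · simp only [crossWord]
    exact absMoment₂_const_mul' (absMoment₂_of_decay510 (by linarith) (decay510_tadpoleWord hB' hW' hδ hN μ ν)) _
  · obtain ⟨Cx, hx⟩ := hleg x
    obtain ⟨Cy, hy⟩ := hleg y
    cases hb : (x || y)
    · simp only [crossWord, hb, cond_false, mul_zero]
      exact absMoment₂_zero_gen
    · simp only [crossWord, hb, cond_true]
      exact absMoment₂_const_mul' (absMoment₂_of_decay510 (by linarith) (decay510_biBubbleWord hx hy hV' hV' hδ hN μ ν)) _

/-- [folklore] **THE (1.22) MOMENT OF THE CROSS CHANNEL IS THE SUM OF THE WORD MOMENTS**: under the hypotheses of `absMoment₂_crossWord`,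
`secondMoment (legCross A B V W) μ ν = Σ_u secondMoment (crossWord A B V W u) μ ν` (1 + 3 genuine words; the pure-`A` slot reads `0`). -/
theorem secondMoment_legCross {A B : MKer D F} {V : Fin D → Site D → MKer D F} {W : Fin D → Site D → Fin D → Site D → MKer D F}
    {CA CB Cv Cw δA δB δv δw : ℝ} {N : ℕ} (hA : Decays A CA δA) (hδA : 0 < δA) (hB : Decays B CB δB) (hδB : 0 < δB)
    (hV : VertexFamily V N Cv δv) (hδv : 0 < δv) (hW : VertexFamily₂ W N Cw δw) (hδw : 0 < δw) (hN : 1 ≤ N) (μ ν : Fin D) :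
    B12Beta.secondMoment (legCross A B V W) μ ν = ∑ u, B12Beta.secondMoment (crossWord A B V W u) μ ν :=
  secondMoment_eq_sum_of_pointwise (fun z => legCross_eq_sum_crossWord A B V W μ ν z)
    fun u => absMoment₂_crossWord hA hδA hB hδB hV hδv hW hδw hN u μ ν

end Cross

/-! ## §4 Road instances over the N-leg (mod `Spr (Ga (m+1) a)`) -/

section Road

variable (m : ℕ) {a : ℝ}

/-- [folklore] **BLOCK WORDS OVER THE ROAD's N-LEG**: for packed families `V`, `W` at the coarse bonds of blocking `m + 1`, every block word of
`blockTerms (NlegRoad m a) V W` is a well-typed (1.22)-kernel (`RWeightedLegPack.spr_NlegRoad`). -/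
theorem absMoment₂_blockWord_NlegRoad (hGa : Spr (GluonLeg.Ga (m + 1) a))
    {V : Fin 4 → Site 4 → MKer 4 (Fib 3)} {W : Fin 4 → Site 4 → Fin 4 → Site 4 → MKer 4 (Fib 3)} {Cv Cw δv δw : ℝ}
    (hV : VertexFamily V (m + 1) Cv δv) (hδv : 0 < δv) (hW : VertexFamily₂ W (m + 1) Cw δw) (hδw : 0 < δw)
    (u : (Bool × Bool) ⊕ (Bool × Bool × Bool × Bool)) (μ ν : Fin 4) :
    AbsMoment₂ (blockWord (NlegRoad m a) V W u μ ν) := by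
  obtain ⟨C, δ, hδ, hK⟩ := spr_NlegRoad m a hGa
  exact absMoment₂_blockWord hK hδ hV hδv hW hδw (Nat.le_add_left 1 m) u μ ν

/-- [folklore] … and the (1.22) moment of the block channel over the N-leg is the sum of the 3 + 15 word moments. -/
theorem secondMoment_blockTerms_NlegRoad (hGa : Spr (GluonLeg.Ga (m + 1) a))
    {V : Fin 4 → Site 4 → MKer 4 (Fib 3)} {W : Fin 4 → Site 4 → Fin 4 → Site 4 → MKer 4 (Fib 3)} {Cv Cw δv δw : ℝ}
    (hV : VertexFamily V (m + 1) Cv δv) (hδv : 0 < δv) (hW : VertexFamily₂ W (m + 1) Cw δw) (hδw : 0 < δw) (μ ν : Fin 4) :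
    B12Beta.secondMoment (blockTerms (NlegRoad m a) V W) μ ν = ∑ u, B12Beta.secondMoment (blockWord (NlegRoad m a) V W u) μ ν := by
  obtain ⟨C, δ, hδ, hK⟩ := spr_NlegRoad m a hGa
  exact secondMoment_blockTerms hK hδ hV hδv hW hδw (Nat.le_add_left 1 m) μ ν

/-- [folklore] **SANDWICH CROSS WORDS OVER THE ROAD's FINE LEG**: for fine-fibre families `V`, `W` at the coarse bonds of blocking `m + 1`, every cross word of the
split leg `½•Ga + (−½)•sandwich_ff` of «NLEG-HESS-SPLIT» (`NlegKHessSplit.hessKer_NlegRoad_split`) is a well-typed (1.22)-kernel. -/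
theorem absMoment₂_crossWord_NlegRoad (hGa : Spr (GluonLeg.Ga (m + 1) a))
    {V : Fin 4 → Site 4 → MKer 4 (Fin 4)} {W : Fin 4 → Site 4 → Fin 4 → Site 4 → MKer 4 (Fin 4)} {Cv Cw δv δw : ℝ}
    (hV : VertexFamily V (m + 1) Cv δv) (hδv : 0 < δv) (hW : VertexFamily₂ W (m + 1) Cw δw) (hδw : 0 < δw) (u : Unit ⊕ (Bool × Bool))
    (μ ν : Fin 4) :
    AbsMoment₂ (crossWord ((2 : ℝ)⁻¹ • GluonLeg.Ga (m + 1) a)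
      ((-(2 : ℝ)⁻¹) • blk (sandP (m + 1) (GluonLeg.Ga (m + 1) a) (multM (m + 1) (2 * a / ((m + 1 : ℕ) : ℝ) ^ 8) 2)) true true) V W u μ ν) := by
  obtain ⟨CA, δA, hδA, hA⟩ := spr_smul' (2 : ℝ)⁻¹ hGa
  obtain ⟨CB, δB, hδB, hB⟩ := spr_smul' (-(2 : ℝ)⁻¹)
    (spr_blk (spr_sandP (m + 1) hGa (spr_multM (m + 1) (2 * a / ((m + 1 : ℕ) : ℝ) ^ 8) 2)) true true)
  exact absMoment₂_crossWord hA hδA hB hδB hV hδv hW hδw (Nat.le_add_left 1 m) u μ ν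

/-- [folklore] … and the (1.22) moment of the sandwich cross channel is the sum of the 1 + 3 word moments. -/
theorem secondMoment_legCross_NlegRoad (hGa : Spr (GluonLeg.Ga (m + 1) a))
    {V : Fin 4 → Site 4 → MKer 4 (Fin 4)} {W : Fin 4 → Site 4 → Fin 4 → Site 4 → MKer 4 (Fin 4)} {Cv Cw δv δw : ℝ}
    (hV : VertexFamily V (m + 1) Cv δv) (hδv : 0 < δv) (hW : VertexFamily₂ W (m + 1) Cw δw) (hδw : 0 < δw) (μ ν : Fin 4) :
    B12Beta.secondMoment (legCross ((2 : ℝ)⁻¹ • GluonLeg.Ga (m + 1) a)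
      ((-(2 : ℝ)⁻¹) • blk (sandP (m + 1) (GluonLeg.Ga (m + 1) a) (multM (m + 1) (2 * a / ((m + 1 : ℕ) : ℝ) ^ 8) 2)) true true) V W) μ ν =
      ∑ u, B12Beta.secondMoment (crossWord ((2 : ℝ)⁻¹ • GluonLeg.Ga (m + 1) a)
        ((-(2 : ℝ)⁻¹) • blk (sandP (m + 1) (GluonLeg.Ga (m + 1) a) (multM (m + 1) (2 * a / ((m + 1 : ℕ) : ℝ) ^ 8) 2)) true true) V W u) μ ν := by
  obtain ⟨CA, δA, hδA, hA⟩ := spr_smul' (2 : ℝ)⁻¹ hGa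
  obtain ⟨CB, δB, hδB, hB⟩ := spr_smul' (-(2 : ℝ)⁻¹)
    (spr_blk (spr_sandP (m + 1) hGa (spr_multM (m + 1) (2 * a / ((m + 1 : ℕ) : ℝ) ^ 8) 2)) true true)
  exact secondMoment_legCross hA hδA hB hδB hV hδv hW hδw (Nat.le_add_left 1 m) μ ν

end Road

end Summit.QuantumFields.BalabanUV.Beta.D1BFx.RestKernelWords

end
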